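import Summits.HodgeConjecture.HodgeConjecture.Theses.MilnorKExponential
import Literature.AlgebraicGeometry.HodgeTheory.ComplexGysin
import Literature.AlgebraicGeometry.HodgeTheory.ComplexConjugationHolds
import Literature.AlgebraicGeometry.Motives.VarietiesProjectiveSpaceProofs

/-!
# `SymbolLiftR` (stmt-HodgeConjecture-18702) · Negative · ceiling, `c = 0` probe, load-bearing bound

Negative knowledge for the crux `MilnorKExponential.SymbolLiftR` (route MilnorKExponential, rank 3;
LIFT_{q+1} for `q + 1 ≤ n`: every rational `(q+1,q+1)` class on a smooth projective complex `n`-fold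
is a symbol class — `∃` Hodge model `A` with (N) a normalisation clause and (S) a symbol clause),
from the standing disprover's work file `Cruxes/SymbolLiftR/Disproof.lean` §1–§5
(refuter-cdisprove-stmt-HodgeConjecture-18702-0, cdisprove cycle 1, 2026-08-17):

* §1 `NormClause A q`, `SymbClause A q c` — the two clauses of the inlined `IsSymbolClass`, verbatim,
  and `symbolLiftR_iff` (`Iff.rfl`): the crux is "rational `(q+1,q+1)` classes, `q + 1 ≤ n`, satisfy
  (N) ∧ (S) in some Hodge model".
* §2 CEILING `not_hodgeConjecture_of_not_symbolLiftR`: with the support item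
  `AlgebraicClassesAreSymbolClasses` (Alg ⊆ L), `¬ SymbolLiftR → ¬ HodgeConjecture` — a refutation of
  the crux is a non-algebraic Hodge class; no degenerate / small model kills it inside `q + 1 ≤ n`.
* §3 `c = 0` PROBE: `symbClause_zero` ((S) is free at `c = 0`: zero cochain on the one-set cover),
  `exists_normClause_of_symbolLiftR`, `symbolLiftR_zero_iff_normClause`: at the zero class the crux
  is EXACTLY the satisfiability of (N) — the cheapest remaining (typing) falsifier, true on paper
  (`O(1)` on `ℙⁿ`, connection forms, rescaled comparison).
* §3b `symbClauseAnyMultiple_trivial`: with `m ≠ 0` dropped, (S) holds for EVERY class (`m = 0`, zero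
  cochain) — `m ≠ 0` is load-bearing, without it the crux collapses to (N).
* §4 LOAD-BEARING, TIGHT `q + 1 ≤ n`: `not_subsingleton_of_normClause` ((N) forces
  `H^{2q+2}(X(ℂ); ℂ) ≠ 0`) and `symbolLiftR_false_without_dimBound` — the variant with
  `q ≤ n` (`SymbolLiftRWeakBound`, which is the crux plus the layer `q = n`) is FALSE: witness
  `X = ℙ⁰_ℂ`, `n = q = 0`, `c = 0` ((N) wants a non-zero rational class in `H²(pt) = 0`).
* §5 `rescale`, `rescale_deRham_apply`, `normClause_rescale`: the `∃ A` ranges over de Rham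
  comparisons up to `ℂˣ` (rescaling a Hodge model's comparison gives a Hodge model), so the period
  factor `(2πi)^{q+1}` of `dlog` transgressions is absorbed by the choice of `A`; (N) is stable
  exactly under `ℚˣ`.

No `sorry`; axioms `propext`, `Classical.choice`, `Quot.sound`.  The `def … : Prop` here are the
variants / clauses of the crux local to this negative record (not cited facts).
-/

noncomputable section

-- The mandated namespace repeats `HodgeConjecture` (single-conjunct summit).
set_option linter.dupNamespace false

namespace Summit.HodgeConjecture.HodgeConjecture.Theorems.SymbolLiftR.Negative.LoadBearing

open scoped Manifold
open Literature.AlgebraicGeometry.HodgeTheory Literature.AlgebraicGeometry.Motives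
open Summit.HodgeConjecture.HodgeConjecture.Theses.MilnorKExponential

variable {n : ℕ} {X : SchemeOver ℂ}

/-! ### §1 The two clauses of the inlined `IsSymbolClass`, named -/

/-- **(N) the normalisation clause** of the inlined `IsSymbolClass` of `SymbolLiftR`, for a FIXED
Hodge model `A` and weight `q + 1` (verbatim the route text): some holomorphic line bundle `L` on
`A.carrier` (finite index type) whose `(q+1)`-fold `dlog`-power Čech cocycle transgresses to a closed
`(2q+2)`-form `θ₀` with `A.deRham [θ₀] = A^* c₀`, `c₀` rational and non-zero.  (A clause / variant of the crux LOCAL to this negative record —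
deliberately not tagged as a cited fact.) -/
def NormClause (A : HodgeModel n X) (q : ℕ) : Prop :=
  let F : ℕ → Type := fun k ↦ Literature.Geometry.Kaehler.MForm 𝓘(ℝ, A.model) A.carrier ℂ k; let CF := Literature.NumberTheory.Transcendental.cclosedSmoothForms A.model A.carrier (2 * q + 1 + 1); let MK := Literature.NumberTheory.Transcendental.complexDeRhamCohomology.mk A.model A.carrier (2 * q + 1 + 1); let DR := A.deRham A.carrier (2 * q + 1 + 1); let T : Type := Fin (q + 1) → (A.carrier → ℂ); let DW : T → F (q + 1) := fun t ↦ Fin.hIterate (fun k : ℕ ↦ F k) (Literature.Geometry.Kaehler.MForm.ofFun 𝓘(ℝ, A.model) (fun _ : A.carrier ↦ (1 : ℂ))) (fun (i : Fin (q + 1)) (acc : F (i : ℕ)) ↦ Literature.Geometry.Kaehler.MForm.wedge acc (fun x : A.carrier ↦ (t i x)⁻¹ • Literature.Geometry.Kaehler.mextDeriv (Literature.Geometry.Kaehler.MForm.ofFun 𝓘(ℝ, A.model) (t i)) x)); let SF : (T →₀ ℤ) → F (q + 1) := fun σ ↦ Finsupp.sum σ fun (t : T) (z : ℤ) ↦ z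 • DW t; let Tr : (ι : Type) → (U : ι → Set A.carrier) → (∀ i, IsOpen (U i)) → ((Fin (q + 2) → ι) → F (q + 1)) → F (2 * q + 1 + 1) → Prop := fun ι U hU w θ ↦ ∃ Z : (a b : ℕ) → Literature.Geometry.Kaehler.CechForms 𝓘(ℝ, A.model) ℂ U a b, (∀ (J : Fin (q + 2) → ι), ∀ x ∈ Literature.Geometry.Kaehler.cechSet U J, ((Literature.Geometry.Kaehler.cechδ 𝓘(ℝ, A.model) ℂ hU q (q + 1) (Z q (q + 1)) J : F (q + 1)) x = w J x)) ∧ (∀ a b : ℕ, a + 1 + b = 2 * q + 1 → a < q → Literature.Geometry.Kaehler.cechd 𝓘(ℝ, A.model) ℂ hU (a + 1) b (Z (a + 1) b) = Literature.Geometry.Kaehler.cechδ 𝓘(ℝ, A.model) ℂ hU a (b + 1) (Z a (b + 1))) ∧ (∀ (J : Fin 1 → ι), ∀ x ∈ Literature.Geometry.Kaehler.cechSet U J, ((Literature.Geometry.Kaehler.cechd 𝓘(ℝ, A.model) ℂ hU 0 (2 * q + 1) (Z 0 (2 * q + 1)) J : F (2 * q + 1 + 1)) x = θ x)); (∃ (ι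 : Type) (_ : Fintype ι) (L : Literature.Geometry.Kaehler.HolomorphicLineBundle ι A.model A.carrier) (θ₀ : CF) (c₀ : Literature.AlgebraicGeometry.HodgeTheory.complexBetti X (2 * q + 1 + 1)), Tr ι L.baseSet L.isOpen_baseSet (fun J ↦ SF (Finsupp.single (fun i : Fin (q + 1) ↦ L.coordChange (J (Fin.castSucc i)) (J i.succ)) 1)) θ₀ ∧ Literature.AlgebraicGeometry.HodgeTheory.IsRationalClass c₀ ∧ c₀ ≠ 0 ∧ DR (MK θ₀) = A.pullback (2 * q + 1 + 1) c₀)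

/-- **(S) the symbol clause** of the inlined `IsSymbolClass` of `SymbolLiftR`, for a FIXED Hodge
model `A`, weight `q + 1` and class `c` (verbatim the route text): a finite open cover, a Čech
`(q+1)`-cochain `σ` of good Milnor-symbol chains, cocycle modulo the naive Milnor relations,
transgressing to `θ` with `A.deRham [θ] = m • A^* c`, `m ≠ 0`.  (A clause / variant of the crux LOCAL to this negative record —
deliberately not tagged as a cited fact.) -/
def SymbClause (A : HodgeModel n X) (q : ℕ) (c : complexBetti X (2 * (q + 1))) : Prop :=
  let F : ℕ → Type := fun k ↦ Literature.Geometry.Kaehler.MForm 𝓘(ℝ, A.model) A.carrier ℂ k; let CF := Literature.NumberTheory.Transcendental.cclosedSmoothForms A.model A.carrier (2 * q + 1 + 1); let MK := Literature.NumberTheory.Transcendental.complexDeRhamCohomology.mk A.model A.carrier (2 * q + 1 + 1); let DR := A.deRham A.carrier (2 * q + 1 + 1); let T : Type := Fin (q + 1) → (A.carrier → ℂ); let IsU : Set A.carrier → (A.carrier → ℂ) → Prop := fun W f ↦ MDifferentiableOn 𝓘(ℂ, A.model) 𝓘(ℂ, ℂ) f W ∧ ∀ x ∈ W, f x ≠ 0;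 let Good : Set A.carrier → T → Prop := fun W t ↦ ∀ i, IsU W (t i); let Rel : Set A.carrier → AddSubgroup (T →₀ ℤ) := fun W ↦ AddSubgroup.closure ({s : T →₀ ℤ | ∃ t t' : T, Good W t ∧ Good W t' ∧ (∀ i, ∀ x ∈ W, t i x = t' i x) ∧ s = Finsupp.single t 1 - Finsupp.single t' 1} ∪ {s : T →₀ ℤ | ∃ (t : T) (i : Fin (q + 1)) (g : A.carrier → ℂ), Good W t ∧ IsU W g ∧ s = Finsupp.single (Function.update t i (t i * g)) 1 - Finsupp.single t 1 - Finsupp.single (Function.update t i g) 1} ∪ {s : T →₀ ℤ | ∃ (t : T) (i j : Fin (q + 1)), Good W t ∧ i ≠ j ∧ (∀ x ∈ W, t i x + t j x = 1) ∧ s = Finsupp.single t 1}); let DW : T → F (q + 1) := fun t ↦ Fin.hIterate (fun k : ℕ ↦ F k) (Literature.Geometry.Kaehler.MForm.ofFun 𝓘(ℝ, A.model) (fun _ : A.carrier ↦ (1 : ℂ))) (fun (i : Fin (q + 1)) (acc : F (i : ℕ)) ↦ Literature.Geometry.Kaehler.MForm.wedge acc (fun x : A.carrier ↦ (t i x)⁻¹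 • Literature.Geometry.Kaehler.mextDeriv (Literature.Geometry.Kaehler.MForm.ofFun 𝓘(ℝ, A.model) (t i)) x)); let SF : (T →₀ ℤ) → F (q + 1) := fun σ ↦ Finsupp.sum σ fun (t : T) (z : ℤ) ↦ z • DW t; let Tr : (ι : Type) → (U : ι → Set A.carrier) → (∀ i, IsOpen (U i)) → ((Fin (q + 2) → ι) → F (q + 1)) → F (2 * q + 1 + 1) → Prop := fun ι U hU w θ ↦ ∃ Z : (a b : ℕ) → Literature.Geometry.Kaehler.CechForms 𝓘(ℝ, A.model) ℂ U a b, (∀ (J : Fin (q + 2) → ι), ∀ x ∈ Literature.Geometry.Kaehler.cechSet U J, ((Literature.Geometry.Kaehler.cechδ 𝓘(ℝ, A.model) ℂ hU q (q + 1) (Z q (q + 1)) J : F (q + 1)) x = w J x)) ∧ (∀ a b : ℕ, a + 1 + b = 2 * q + 1 → a < q → Literature.Geometry.Kaehler.cechd 𝓘(ℝ, A.model) ℂ hU (a + 1) b (Z (a + 1) b) = Literature.Geometry.Kaehler.cechδ 𝓘(ℝ, A.model) ℂ hU a (b + 1) (Z a (b + 1))) ∧ (∀ (J : Fin 1 → ι),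 ∀ x ∈ Literature.Geometry.Kaehler.cechSet U J, ((Literature.Geometry.Kaehler.cechd 𝓘(ℝ, A.model) ℂ hU 0 (2 * q + 1) (Z 0 (2 * q + 1)) J : F (2 * q + 1 + 1)) x = θ x)); (∃ (ι : Type) (_ : Fintype ι) (U : ι → Set A.carrier) (hU : ∀ i, IsOpen (U i)) (_ : ∀ x, ∃ i, x ∈ U i) (σ : (Fin (q + 2) → ι) → (T →₀ ℤ)) (_ : ∀ J, ∀ t ∈ (σ J).support, Good (Literature.Geometry.Kaehler.cechSet U J) t) (_ : ∀ J' : Fin (q + 3) → ι, (∑ j : Fin (q + 3), ((-1 : ℤ) ^ (j : ℕ)) • σ (J' ∘ Fin.succAbove j)) ∈ Rel (Literature.Geometry.Kaehler.cechSet U J')) (θ : CF) (m : ℤ), m ≠ 0 ∧ Tr ι U hU (fun J ↦ SF (σ J)) θ ∧ DR (MK θ) = (m : ℂ) • A.pullback (2 * q + 1 + 1) c)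

/-- `SymbolLiftR` is, definitionally, "rational `(q+1,q+1)` classes with `q + 1 ≤ n` satisfy
(N) ∧ (S) in some Hodge model". [folklore] -/
theorem symbolLiftR_iff :
    SymbolLiftR ↔ ∀ ⦃n : ℕ⦄ ⦃X : SchemeOver ℂ⦄, IsSmoothProjective n X → ∀ (q : ℕ), q + 1 ≤ n →
      ∀ (c : complexBetti X (2 * (q + 1))), IsRationalClass c →
        IsOfHodgeType n X (2 * (q + 1)) (q + 1) (q + 1) c →
          ∃ A : HodgeModel n X, NormClause A q ∧ SymbClause A q c :=
  Iff.rfl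

/-! ### §2 Ceiling: under Alg ⊆ L the crux is implied by the Hodge conjecture -/

/-- The support item `AlgebraicClassesAreSymbolClasses` (Alg ⊆ L) has, definitionally, the SAME two
clauses as conclusion: "rational algebraic classes of codimension `q + 1 ≤ n` satisfy (N) ∧ (S) in some
Hodge model" — which is what makes the ceiling below a one-liner. [folklore] -/
theorem algebraicClassesAreSymbolClasses_iff :
    AlgebraicClassesAreSymbolClasses ↔ ∀ ⦃n : ℕ⦄ ⦃X : SchemeOver ℂ⦄, IsSmoothProjective n X →
      ∀ (q : ℕ), q + 1 ≤ n → ∀ (c : complexBetti X (2 * (q + 1))), IsRationalClass c →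
        c ∈ algebraicClasses X (q + 1) → ∃ A : HodgeModel n X, NormClause A q ∧ SymbClause A q c :=
  Iff.rfl

/-- **CEILING: `¬ SymbolLiftR → (Alg ⊆ L) → ¬ HodgeConjecture`.** Under the Hodge conjecture a
rational `(q+1,q+1)` class is algebraic, and the support item `AlgebraicClassesAreSymbolClasses`
(Alg ⊆ L: 2001 Thm A, Bloch–Quillen–Kerz + the `dlog` fundamental class) makes it a symbol class —
verbatim the conclusion of `SymbolLiftR`.  So every refutation of this crux is a non-algebraic Hodge
class (a counterexample to the summit) unless the typing item Alg ⊆ L is itself refuted; in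
particular no degenerate / small-model kill exists inside `q + 1 ≤ n`. [folklore] -/
theorem not_hodgeConjecture_of_not_symbolLiftR (h : ¬ SymbolLiftR)
    (hAlg : AlgebraicClassesAreSymbolClasses) : ¬ _root_.HodgeConjecture :=
  fun hHC ↦ h fun _n _X hX q hq c hc hpp ↦ hAlg hX q hq c hc ((hHC hX).2 (q + 1) c hc hpp)

/-! ### §3 The `c = 0` probe: at the zero class the crux is exactly the normalisation clause -/

/-- **(S) holds for `c = 0` in every Hodge model**: the zero symbol cochain on the one-set cover
`{univ}`, zigzag `Z = 0`, `θ = 0`, `m = 1`. [folklore] -/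
theorem symbClause_zero (A : HodgeModel n X) (q : ℕ) : SymbClause A q 0 := by
  dsimp only [SymbClause]
  refine ⟨Unit, inferInstance, fun _ ↦ Set.univ, fun _ ↦ isOpen_univ, fun x ↦ ⟨(), Set.mem_univ x⟩,
    fun _ ↦ 0, ?_, ?_, 0, 1, one_ne_zero, ⟨fun _ _ ↦ 0, ?_, ?_, ?_⟩, ?_⟩
  · intro J t ht
    simp at ht
  · intro J'
    simp only [smul_zero, Finset.sum_const_zero]
    exact zero_mem _
  · intro J x _
    simp
  · intro a b _ _
    simp only [map_zero]
  · intro J x _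
    simp
  · simp

/-- (S) with the side condition `m ≠ 0` DROPPED (everything else verbatim).  (A clause / variant of the crux LOCAL to this negative record —
deliberately not tagged as a cited fact.) -/
def SymbClauseAnyMultiple (A : HodgeModel n X) (q : ℕ) (c : complexBetti X (2 * (q + 1))) : Prop :=
  let F : ℕ → Type := fun k ↦ Literature.Geometry.Kaehler.MForm 𝓘(ℝ, A.model) A.carrier ℂ k; let CF := Literature.NumberTheory.Transcendental.cclosedSmoothForms A.model A.carrier (2 * q + 1 + 1); let MK := Literature.NumberTheory.Transcendental.complexDeRhamCohomology.mk A.model A.carrier (2 * q + 1 + 1); let DR := A.deRham A.carrier (2 * q + 1 + 1); let T : Type := Fin (q + 1) → (A.carrier → ℂ); let IsU : Set A.carrier → (A.carrier → ℂ) → Prop := fun W f ↦ MDifferentiableOn 𝓘(ℂ, A.model) 𝓘(ℂ, ℂ) f W ∧ ∀ x ∈ W, f x ≠ 0; let Good : Set A.carrier → T → Prop := fun W t ↦ ∀ i, IsU W (t i); let Rel : Set A.carrier → AddSubgroup (T →₀ ℤ) := fun W ↦ AddSubgroup.closure ({s : T →₀ ℤ | ∃ t t' : T, Good W t ∧ Good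 W t' ∧ (∀ i, ∀ x ∈ W, t i x = t' i x) ∧ s = Finsupp.single t 1 - Finsupp.single t' 1} ∪ {s : T →₀ ℤ | ∃ (t : T) (i : Fin (q + 1)) (g : A.carrier → ℂ), Good W t ∧ IsU W g ∧ s = Finsupp.single (Function.update t i (t i * g)) 1 - Finsupp.single t 1 - Finsupp.single (Function.update t i g) 1} ∪ {s : T →₀ ℤ | ∃ (t : T) (i j : Fin (q + 1)), Good W t ∧ i ≠ j ∧ (∀ x ∈ W, t i x + t j x = 1) ∧ s = Finsupp.single t 1}); let DW : T → F (q + 1) := fun t ↦ Fin.hIterate (fun k : ℕ ↦ F k) (Literature.Geometry.Kaehler.MForm.ofFun 𝓘(ℝ, A.model) (fun _ : A.carrier ↦ (1 : ℂ))) (fun (i : Fin (q + 1)) (acc : F (i : ℕ)) ↦ Literature.Geometry.Kaehler.MForm.wedge acc (fun x : A.carrier ↦ (t i x)⁻¹ • Literature.Geometry.Kaehler.mextDeriv (Literature.Geometry.Kaehler.MForm.ofFun 𝓘(ℝ, A.model) (t i)) x)); let SF : (T →₀ ℤ) → F (q + 1) := fun σ ↦ Finsupp.sum σ fun (t : T)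 (z : ℤ) ↦ z • DW t; let Tr : (ι : Type) → (U : ι → Set A.carrier) → (∀ i, IsOpen (U i)) → ((Fin (q + 2) → ι) → F (q + 1)) → F (2 * q + 1 + 1) → Prop := fun ι U hU w θ ↦ ∃ Z : (a b : ℕ) → Literature.Geometry.Kaehler.CechForms 𝓘(ℝ, A.model) ℂ U a b, (∀ (J : Fin (q + 2) → ι), ∀ x ∈ Literature.Geometry.Kaehler.cechSet U J, ((Literature.Geometry.Kaehler.cechδ 𝓘(ℝ, A.model) ℂ hU q (q + 1) (Z q (q + 1)) J : F (q + 1)) x = w J x)) ∧ (∀ a b : ℕ, a + 1 + b = 2 * q + 1 → a < q → Literature.Geometry.Kaehler.cechd 𝓘(ℝ, A.model) ℂ hU (a + 1) b (Z (a + 1) b) = Literature.Geometry.Kaehler.cechδ 𝓘(ℝ, A.model) ℂ hU a (b + 1) (Z a (b + 1))) ∧ (∀ (J : Fin 1 → ι), ∀ x ∈ Literature.Geometry.Kaehler.cechSet U J, ((Literature.Geometry.Kaehler.cechd 𝓘(ℝ, A.model) ℂ hU 0 (2 * q + 1) (Z 0 (2 * q + 1)) J : F (2 * q + 1 + 1))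 x = θ x)); (∃ (ι : Type) (_ : Fintype ι) (U : ι → Set A.carrier) (hU : ∀ i, IsOpen (U i)) (_ : ∀ x, ∃ i, x ∈ U i) (σ : (Fin (q + 2) → ι) → (T →₀ ℤ)) (_ : ∀ J, ∀ t ∈ (σ J).support, Good (Literature.Geometry.Kaehler.cechSet U J) t) (_ : ∀ J' : Fin (q + 3) → ι, (∑ j : Fin (q + 3), ((-1 : ℤ) ^ (j : ℕ)) • σ (J' ∘ Fin.succAbove j)) ∈ Rel (Literature.Geometry.Kaehler.cechSet U J')) (θ : CF) (m : ℤ), Tr ι U hU (fun J ↦ SF (σ J)) θ ∧ DR (MK θ) = (m : ℂ) • A.pullback (2 * q + 1 + 1) c)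

/-- **`m ≠ 0` is load-bearing in (S): without it the symbol clause holds for EVERY class** (zero
cochain, `θ = 0`, `m = 0`), so the crux would collapse to (N) alone. [folklore] -/
theorem symbClauseAnyMultiple_trivial (A : HodgeModel n X) (q : ℕ) (c : complexBetti X (2 * (q + 1))) :
    SymbClauseAnyMultiple A q c := by
  dsimp only [SymbClauseAnyMultiple]
  refine ⟨Unit, inferInstance, fun _ ↦ Set.univ, fun _ ↦ isOpen_univ, fun x ↦ ⟨(), Set.mem_univ x⟩,
    fun _ ↦ 0, ?_, ?_, 0, 0, ⟨fun _ _ ↦ 0, ?_, ?_, ?_⟩, ?_⟩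
  · intro J t ht
    simp at ht
  · intro J'
    simp only [smul_zero, Finset.sum_const_zero]
    exact zero_mem _
  · intro J x _
    simp
  · intro a b _ _
    simp only [map_zero]
  · intro J x _
    simp
  · simp

/-- **SymbolLiftR ⟹ (N) is satisfiable on every smooth projective `X` in every weight `q + 1 ≤ n`**
(apply the crux to the rational `(q+1,q+1)` class `c = 0`). This is the cheapest remaining
falsifier: a smooth projective `X`, `q < dim X`, with NO Hodge model carrying a holomorphic line
bundle whose `dlog`-power cocycle transgresses to a non-zero rational class kills the crux.
[folklore] -/
theorem exists_normClause_of_symbolLiftR (h : SymbolLiftR) (hX : IsSmoothProjective n X) (q : ℕ)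
    (hq : q + 1 ≤ n) : ∃ A : HodgeModel n X, NormClause A q := by
  obtain ⟨A⟩ := nonempty_hodgeModel_holds hX
  obtain ⟨A', hN, -⟩ := h hX q hq 0 IsRationalClass.zero (IsOfHodgeType.zero A _ _ _)
  exact ⟨A', hN⟩

/-- **At `c = 0` the conclusion of the crux is EQUIVALENT to the satisfiability of (N).** [folklore] -/
theorem symbolLiftR_zero_iff_normClause (q : ℕ) :
    (∃ A : HodgeModel n X, NormClause A q ∧ SymbClause A q 0) ↔ ∃ A : HodgeModel n X, NormClause A q :=
  ⟨fun ⟨A, hN, _⟩ ↦ ⟨A, hN⟩, fun ⟨A, hN⟩ ↦ ⟨A, hN, symbClause_zero A q⟩⟩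

/-! ### §4 Load-bearing hypothesis `q + 1 ≤ n` (tight) -/

/-- **(N) forces a non-zero rational class in degree `2q + 2`**: in particular `H^{2q+2}(X(ℂ); ℂ) ≠ 0`.
This is the only content of (N) the tree can presently extract, and it is what the dimension bound
protects (below). [folklore] -/
theorem not_subsingleton_of_normClause {A : HodgeModel n X} {q : ℕ} (h : NormClause A q) :
    ¬ Subsingleton (complexBetti X (2 * q + 1 + 1)) := by
  obtain ⟨ι, _, L, θ₀, c₀, -, -, hc₀, -⟩ := h
  exact fun hs ↦ hc₀ (Subsingleton.elim _ _)


/-- `SymbolLiftR` with the dimension bound weakened by one, `q ≤ n` instead of `q + 1 ≤ n`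
(everything else verbatim): the crux plus the layer `q = n` (it trivially implies the crux, by
`Nat.le_of_succ_le`).  (A clause / variant of the crux LOCAL to this negative record —
deliberately not tagged as a cited fact.) -/
def SymbolLiftRWeakBound : Prop :=
  ∀ ⦃n : ℕ⦄ ⦃X : SchemeOver ℂ⦄, IsSmoothProjective n X → ∀ (q : ℕ), q ≤ n →
    ∀ (c : complexBetti X (2 * (q + 1))), IsRationalClass c →
      IsOfHodgeType n X (2 * (q + 1)) (q + 1) (q + 1) c →
        ∃ A : HodgeModel n X, NormClause A q ∧ SymbClause A q c

/-- **`q + 1 ≤ n` is load-bearing and tight: `¬ SymbolLiftRWeakBound`.** At `q = n` the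
normalisation clause asks for a non-zero rational class `c₀ ∈ H^{2n+2}(X(ℂ); ℂ) = 0`
(`subsingleton_complexBetti`), while `c = 0` is a rational `(n+1,n+1)` class. Witness `X = ℙ⁰_ℂ`,
`n = q = 0`, `c = 0` (the witness of `MilnorKExponentialSymbolLift_refuted`, re-filed against the
live decl's clauses). Any proof of the crux must use `q + 1 ≤ n` exactly. [folklore] -/
theorem symbolLiftR_false_without_dimBound : ¬ SymbolLiftRWeakBound := by
  intro h
  have hX : IsSmoothProjective 0 (projectiveSpace 0 ℂ) := isSmoothProjective_projectiveSpace_holds ℂ 0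
  obtain ⟨A⟩ := nonempty_hodgeModel_holds hX
  obtain ⟨A', hN, -⟩ := h hX 0 le_rfl 0 IsRationalClass.zero (IsOfHodgeType.zero A _ _ _)
  exact not_subsingleton_of_normClause hN (subsingleton_complexBetti hX (by norm_num))


/-! ### §5 Why `(2πi)^{q+1}` is not an obstruction: Hodge models rescale -/

/-- **Rescaling the de Rham comparison of a Hodge model.** For `s ≠ 0`, the same analytification
with the comparison family `s • A.deRham` (every degree, every manifold charted on `A.model`) is
again a Hodge model: naturality is `ℂ`-linear and the Hodge decomposition field does not mention the
comparison.  So the `∃ A` of the crux ranges over comparisons up to (at least) `ℂˣ`, and the factor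
`(2πi)^{q+1}` by which `dlog`-transgressions miss `H^{2q+2}(X; ℚ)` under the integration comparison
is absorbed by the choice of `A`; the normalisation clause (N) is what pins the scalar, to
`(2πi)^{-(q+1)} ℚˣ`·(integration).  (A construction LOCAL to this negative record — deliberately
not tagged as a cited fact.) -/
def rescale (A : HodgeModel n X) (s : ℂ) (hs : s ≠ 0) : HodgeModel n X where
  model := A.model
  carrier := A.carrier
  toComplexPoints := A.toComplexPoints
  isAnalytification := A.isAnalytification
  deRham := fun M _ _ _ _ _ k ↦ (A.deRham M k).trans (LinearEquiv.smulOfNeZero ℂ _ s hs)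
  deRham_isNatural := by
    intro M N _ _ _ _ _ _ _ _ _ _ _ f hf k c
    have h := A.deRham_isNatural M N f hf k c
    show s • A.deRham M k (Literature.NumberTheory.Transcendental.complexDeRhamCohomology.map A.model hf k c) =
      Literature.AlgebraicTopology.SingularHomology.singularCohomology.map ℂ ℂ ⟨f, hf.continuous⟩ k
        (s • A.deRham N k c)
    rw [h, map_smul]
  isInternal_hodgePQ := A.isInternal_hodgePQ

/-- The rescaled comparison is `s •` the old one (definitional). [folklore] -/
theorem rescale_deRham_apply (A : HodgeModel n X) {s : ℂ} (hs : s ≠ 0) (k : ℕ)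
    (x : Literature.NumberTheory.Transcendental.complexDeRhamCohomology A.model A.carrier k) :
    (rescale A s hs).deRham (rescale A s hs).carrier k x = s • A.deRham A.carrier k x :=
  rfl

/-- **(N) is stable under RATIONAL rescaling** (`c₀ ↦ r • c₀`): the normalisation pins the comparison
only up to `ℚˣ` — exactly the ambiguity that is harmless for `A.deRham [θ] = m • A^* c` with `c`
rational, `m ∈ ℤ ∖ {0}`.  (For irrational `s` the rescaled model fails (N) on paper — the set of
transgression classes is countable — but the tree cannot prove it: near-miss §6.) [folklore] -/
theorem normClause_rescale (A : HodgeModel n X) (q : ℕ) (h : NormClause A q) (r : ℚ) (hr : r ≠ 0) :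
    NormClause (rescale A r (by exact_mod_cast hr)) q := by
  dsimp only [NormClause] at h ⊢
  obtain ⟨ι, _, L, θ₀, c₀, hTr, hc₀, hne, hDR⟩ := h
  refine ⟨ι, inferInstance, L, θ₀, (r : ℂ) • c₀, hTr, hc₀.smul r, smul_ne_zero (by exact_mod_cast hr) hne, ?_⟩
  change (r : ℂ) • A.deRham A.carrier (2 * q + 1 + 1)
      (Literature.NumberTheory.Transcendental.complexDeRhamCohomology.mk A.model A.carrier (2 * q + 1 + 1) θ₀) =
    A.pullback (2 * q + 1 + 1) ((r : ℂ) • c₀)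
  rw [hDR, map_smul]

end Summit.HodgeConjecture.HodgeConjecture.Theorems.SymbolLiftR.Negative.LoadBearing

end
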